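import Literature.NumberTheory.IwasawaTheory.Greenberg2006.CohomologyCofiniteGenerationLeTwoOfTate
import HarnessLib

/-!
# Greenberg 2006, Prop. 3.2 in degrees `≤ 2` AT A TOTALLY COMPLEX FIELD from Tate's global Euler–Poincaré
# characteristic (Milne I Thm. 5.1) AT TOTALLY COMPLEX FIELDS — reading lemma

Topic `NumberTheory/IwasawaTheory/Greenberg2006`; namespace
`Literature.NumberTheory.IwasawaTheory.Greenberg2006`; THEOREMS ONLY (no definition, no named fact,
no `sorry`, no instance).

Twin of `prop32_global_le_two_of_tate` (`CohomologyCofiniteGenerationLeTwoOfTate`) for a consumer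
that carries Tate's formula BY NAME ONLY AT TOTALLY COMPLEX FIELDS
(`∀ L [IsTotallyComplex L], tateGlobalEulerPoincareCharacteristic L` — the shape a class-formation
proof of Milne I Thm. 5.1 at totally complex fields delivers) and reads Prop. 3.2 at a totally
complex `K` (on the Eisenstein-primes line: an imaginary quadratic field): `prop32_global_le_two_of_tate_tc`,
in the exact binder shape of `prop32_cohomology_isCofinitelyGenerated.global` plus the instance
`[IsTotallyComplex K]` and the degree bound `i ≤ 2` (auto-param).  Also the per-field pair
`prop32_le_two_of_tate_tc_at`.

## References
* R. Greenberg, *On the structure of certain Galois cohomology groups*, Doc. Math. Extra Vol.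
  Coates (2006) 335–391, §3 A Prop. 3.2 (p. 358). [Greenberg2006]
* J. S. Milne, *Arithmetic Duality Theorems*, 2nd ed. (2006), I Thm. 5.1 (p. 67). [MilneADT2006]
-/

noncomputable section

open scoped Classical
open NumberField IsDedekindDomain Field IsLocalRing
open Literature.NumberTheory.GaloisRepresentations
open Literature.NumberTheory.GaloisCohomology
open Literature.NumberTheory.IwasawaTheory.Greenberg2016

namespace Literature.NumberTheory.IwasawaTheory.Greenberg2006

/-- **READING LEMMA — Prop. 3.2, global case (ii), IN DEGREES `i ≤ 2`, at a TOTALLY COMPLEX `K`, from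
Tate's formula by name AT TOTALLY COMPLEX FIELDS**: the binder shape of
`prop32_cohomology_isCofinitelyGenerated.global` with the named fact replaced by
`∀ L [IsTotallyComplex L], tateGlobalEulerPoincareCharacteristic L`, the instance `[IsTotallyComplex K]`,
and `i ≤ 2` as an auto-param. [cite: Greenberg2006, Prop. 3.2 (p. 358)]
[cite: MilneADT2006, Ch. I §5, Thm. 5.1 (p. 67)] -/
theorem prop32_global_le_two_of_tate_tc
    (h : ∀ (L : Type) [Field L] [NumberField L] [IsTotallyComplex L],
      tateGlobalEulerPoincareCharacteristic L)
    {p : ℕ} [Fact p.Prime] {K : Type} [Field K]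
    [NumberField K] [IsTotallyComplex K] {S : Set (HeightOneSpectrum (𝓞 K))} (hSf : S.Finite)
    (hS : ∀ v : HeightOneSpectrum (𝓞 K), ((p : ℕ) : 𝓞 K) ∈ v.asIdeal → v ∈ S)
    {Λ : Type} [CommRing Λ] [TopologicalSpace Λ] [IsTopologicalRing Λ] {mΛ : ℕ}
    (hΛ : Nonempty (Λ ≃+* MvPowerSeries (Fin mΛ) ℤ_[p]))
    {D : Type} [AddCommGroup D] [Module Λ D] [TopologicalSpace D] [DiscreteTopology D]
    [ContinuousSMul Λ D] (ρ : ContinuousRep (GaloisGroupUnramifiedOutside K S) Λ D)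
    (hp : ∀ d : D, ∃ n : ℕ, (p ^ n : ℤ) • d = 0) (hcf : IsCofinitelyGenerated Λ D) (i : ℕ)
    (hi : i ≤ 2 := by omega) :
    IsCofinitelyGenerated Λ (ρ.H i) := by
  have _ := hp
  obtain ⟨e⟩ := hΛ
  exact isCofinitelyGenerated_H_le_two_of_tate (h K) S hSf hS e ρ hcf hi

/-- **The pair a consumer of Prop. 3.2 reads at a TOTALLY COMPLEX `K`, in degrees `≤ 2`, from Tate's
formula at totally complex fields**: (`∀ i ≤ 2`, `Hⁱ(K_Σ/K, 𝒟)` cofinitely generated) ∧ (`∀ v i`,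
`Hⁱ(K_v, 𝒟)` cofinitely generated, unconditional). [cite: Greenberg2006, Prop. 3.2 (p. 358)]
[cite: MilneADT2006, Ch. I §5, Thm. 5.1 (p. 67)] -/
theorem prop32_le_two_of_tate_tc_at {K : Type} [Field K] [NumberField K] [IsTotallyComplex K]
    (hT : ∀ (L : Type) [Field L] [NumberField L] [IsTotallyComplex L],
      tateGlobalEulerPoincareCharacteristic L)
    {p : ℕ} [Fact p.Prime] (S : Set (HeightOneSpectrum (𝓞 K))) (hS : S.Finite)
    (hSp : ∀ v : HeightOneSpectrum (𝓞 K), ((p : ℕ) : 𝓞 K) ∈ v.asIdeal → v ∈ S)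
    {Λ : Type} [CommRing Λ] [TopologicalSpace Λ] [IsTopologicalRing Λ] {mΛ : ℕ}
    (e : Λ ≃+* MvPowerSeries (Fin mΛ) ℤ_[p])
    {D : Type} [AddCommGroup D] [Module Λ D] [TopologicalSpace D] [DiscreteTopology D]
    [ContinuousSMul Λ D] (ρ : ContinuousRep (GaloisGroupUnramifiedOutside K S) Λ D)
    (hD : IsCofinitelyGenerated Λ D) :
    (∀ i ≤ 2, IsCofinitelyGenerated Λ (ρ.H i)) ∧
      ∀ (v : NumberField.Place K) (i : ℕ), IsCofinitelyGenerated Λ ((localRep S ρ v).H i) :=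
  prop32_le_two_of_tate_at (hT K) S hS hSp e ρ hD

end Literature.NumberTheory.IwasawaTheory.Greenberg2006

end
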